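import Summits.PneNP.PneNP.Theses.ReslinMediumCover
import Mathlib.Analysis.SpecificLimits.Normed
import Mathlib.Analysis.SpecialFunctions.Pow.Real

/-!
# PneNP / ReslinMediumCover — the growth estimate `n^c < 2^{⌊√(n/3)⌋/2}` eventually
(support item stmt-PneNP-19702 `SubexpGrowth`)

Route `PneNP/ReslinMediumCover` (draft), support item `SubexpGrowth`: for every `c`, eventually in
`n`, `n^c < 2^{⌊√(n/3)⌋ / 2}` (real exponent). Calculus: with `m = ⌊√(n/3)⌋` one has
`n < 3 (m + 2)²`, so `n^c ≤ 12^c m^{2c}` for `m ≥ 2`, and `m^{2c} / (√2)^m → 0`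
(`tendsto_pow_const_div_const_pow_of_one_lt`), while `(√2)^m = 2^{m/2}`.

References: S. Jukna, *Boolean Function Complexity* (2012), §18.7 (the shape `2^{Ω(√n)}` vs
polynomial of the Tseitin bounds); folklore calculus.
-/

namespace Summit.PneNP.PneNP.Theorems

-- `Summit.PneNP.PneNP` repeats a path component by design (summit = sub-problem); silence the linter.
set_option linter.dupNamespace false

namespace TseitinMajSemantics

open Filter

/-- Polynomial versus exponential: for every `c`, eventually in `m`, `12^c · m^{2c} < (√2)^m`. -/
theorem eventually_pow_lt_sqrt_two_pow (c : ℕ) :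
    ∀ᶠ m : ℕ in atTop, (12 : ℝ) ^ c * (m : ℝ) ^ (2 * c) < Real.sqrt 2 ^ m := by
  have hr : (1 : ℝ) < Real.sqrt 2 := by
    rw [show (1 : ℝ) = Real.sqrt 1 by simp]
    exact Real.sqrt_lt_sqrt (by norm_num) (by norm_num)
  have ht := tendsto_pow_const_div_const_pow_of_one_lt (2 * c) hr
  have hε : (0 : ℝ) < ((12 : ℝ) ^ c)⁻¹ := by positivity
  have hev := ht.eventually (gt_mem_nhds hε)
  filter_upwards [hev] with m hm
  have hpos : (0 : ℝ) < Real.sqrt 2 ^ m := pow_pos (by positivity) m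
  rw [div_lt_iff₀ hpos] at hm
  have h12 : (0 : ℝ) < (12 : ℝ) ^ c := by positivity
  calc (12 : ℝ) ^ c * (m : ℝ) ^ (2 * c) < (12 : ℝ) ^ c * (((12 : ℝ) ^ c)⁻¹ * Real.sqrt 2 ^ m) :=
        mul_lt_mul_of_pos_left hm h12
    _ = Real.sqrt 2 ^ m := by field_simp

/-- `(√2)^m = 2^{m/2}` as a real power. -/
theorem sqrt_two_pow_eq_rpow (m : ℕ) : Real.sqrt 2 ^ m = (2 : ℝ) ^ ((m : ℝ) / 2) := by
  rw [Real.sqrt_eq_rpow, ← Real.rpow_natCast, ← Real.rpow_mul (by norm_num : (0 : ℝ) ≤ 2)]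
  congr 1
  ring

end TseitinMajSemantics

/-- **Growth estimate** — support item `SubexpGrowth` of route PneNP/ReslinMediumCover
(stmt-PneNP-19702): for every `c`, eventually `n^c < 2^{⌊√(n/3)⌋/2}`. [folklore] -/
theorem subexpGrowth_proof : Summit.PneNP.PneNP.Theses.ReslinMediumCover.SubexpGrowth := by
  intro c
  obtain ⟨M, hM⟩ := Filter.eventually_atTop.mp (TseitinMajSemantics.eventually_pow_lt_sqrt_two_pow c)
  rw [Filter.eventually_atTop]
  -- beyond `3 (M + 2)²` the integer square root `m = ⌊√(n/3)⌋` is `≥ M + 2 ≥ 2`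
  refine ⟨3 * (M + 2) ^ 2, fun n hn => ?_⟩
  set m : ℕ := Nat.sqrt (n / 3) with hm
  have hmM : M + 2 ≤ m := by
    rw [hm, Nat.le_sqrt']
    omega
  have hm2 : 2 ≤ m := by omega
  -- `n < 3 (m + 2)²`
  have hn_lt : n < 3 * (m + 2) ^ 2 := by
    have h1 : n / 3 < (m + 1) ^ 2 := Nat.lt_succ_sqrt' (n / 3)
    have h2 : n < 3 * ((m + 1) ^ 2) + 3 := by omega
    nlinarith
  -- real-number chain
  have hnR : (n : ℝ) ≤ 3 * ((m : ℝ) + 2) ^ 2 := by exact_mod_cast hn_lt.le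
  have hmR : (2 : ℝ) ≤ m := by exact_mod_cast hm2
  have hstep1 : (n : ℝ) ^ c ≤ (3 * ((m : ℝ) + 2) ^ 2) ^ c :=
    pow_le_pow_left₀ (by positivity) hnR c
  have hstep2 : (3 * ((m : ℝ) + 2) ^ 2) ^ c ≤ (12 : ℝ) ^ c * (m : ℝ) ^ (2 * c) := by
    have h : 3 * ((m : ℝ) + 2) ^ 2 ≤ 12 * (m : ℝ) ^ 2 := by nlinarith
    calc (3 * ((m : ℝ) + 2) ^ 2) ^ c ≤ (12 * (m : ℝ) ^ 2) ^ c := pow_le_pow_left₀ (by positivity) h c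
      _ = (12 : ℝ) ^ c * (m : ℝ) ^ (2 * c) := by rw [mul_pow, ← pow_mul]
  have hstep3 := hM m (by omega)
  rw [TseitinMajSemantics.sqrt_two_pow_eq_rpow] at hstep3
  exact lt_of_le_of_lt (hstep1.trans hstep2) hstep3

end Summit.PneNP.PneNP.Theorems
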